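import Mathlib
import Literature.Analysis.FluidPDE.ChoiEtAl2017PeriodicHouLuoKernel
import HarnessLib

/-!
# Choi–Hou–Kiselev–Luo–Šverák–Yao 2017, §4 Lemma 7: kernel facts for the truncated
# symmetrisation (continuity of `K`, `G = K_x` off the diagonal, the levels `s = (1+δ)^{±1}`,
# bounds on `φ′` off the band, the sign of `G` below the diagonal)

HONEST FRAMING (cell ns-blowup GROUP B «PROFILE SEARCH», zones Z3-b′ / Z8 = the Hou–Luo boundary
MODEL): **1-D MODEL (Hou–Luo), not Euler/NS.** Proof-only companion of
`ChoiEtAl2017PeriodicHouLuoKernel.lean` (Lemma 6: `K = φ(s)`, `s = tan(μy)/tan(μx)`,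
`φ(s) = s log|(s+1)/(s−1)|`; §8 there: `φ′`, `G = K_x`, `T`, `T ≤ 0`). Source: K. Choi, T. Y. Hou,
A. Kiselev, G. Luo, V. Šverák, Y. Yao, Comm. Pure Appl. Math. **70** (2017) 2218–2243 =
arXiv:1407.4776 [ChoiHouKiselevLuoSverakYao2017], §4 proof of Lemma 7, p. 12: "`I₂ = −(1/π)∫∫
ω_r(x)ω_r(y)cot(y)G(x,y) dxdy = (1/2π)∫∫ ω_r(x)ω_r(y)T(x,y) dxdy`", a symmetrisation of a
principal-value integral (`G = K_x ∼ 1/(x−y)` on the diagonal). The rigorous version used by this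
project truncates at the LEVELS `s ∈ ((1+δ)⁻¹, 1+δ)` of `s = tan(μy)/tan(μx)` — a region symmetric
under `(x,y) ↦ (y,x)` (`s ↦ 1/s`) on whose boundary `K` is CONSTANT (`φ(1+δ)`, `φ((1+δ)⁻¹)`) —
and this file supplies the pointwise kernel facts that truncation needs.

## What is proved (no definitions, no named facts; net debt 0)

* `hlRatio_eq_mul_cos_div_sin` — `s(x,y) = tan(μy)·cos(μx)/sin(μx)` (so `s`, `K`, `G` are
  continuous in `x` up to `x = ½L`, where Lean's `tan(π/2) = 0`);
* `continuousAt_hlKernelFn`, `continuousAt_hlKernelFnDeriv` (off `s = ±1`),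
  `continuousOn_hlKernel_left`, `continuousOn_hlKernelDx_left` — `x ↦ K(x,y)`, `x ↦ G(x,y)` are
  continuous on `{x ∈ (0, ½L] : s(x,y) ≠ 1}`;
* `hlKernelFn_inv` — `φ(1/s) = φ(s)/s²`; `hlKernel_of_tan_eq` — `K(c,y) = φ(λ⁻¹…)` at a point `c`
  with `tan(μc) = λ tan(μy)`;
* `hlKernelFnDeriv_nonneg_of_lt_one`, `hlKernelDx_nonpos` — `φ′ ≥ 0` on `[0,1)`, hence
  `G(x,y) ≤ 0` for `y < x` ("`K(x,y)` is decreasing in `x` for `y < x`", Lemma 6 (c));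
* `abs_hlKernelFnDeriv_le` — `|φ′(s)| ≤ log((2+δ)/δ) + 2(1+δ)/(δ(2+δ))` for `s ≥ 0` off the band
  `((1+δ)⁻¹, 1+δ)`; `mul_cot_mul_hlKernelDx` — `ω(y)cot(μy)·G(x,y) = −μ ω(y) φ′(s)/sin²(μx)`;
* `sub_le_of_tan_eq` — two points `c₋ < c₊` of `(0, ½L)` with `tan(μc_∓) = (1+δ)^{∓1} tan(μy)`
  satisfy `c₊ − c₋ ≤ (2L/π)·δ` (`0 < δ ≤ 1`); `mul_hlKernelFn_one_add_le` — `δ·φ(1+δ) ≤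
  2(1+δ)√(δ(2+δ))` (the boundary terms of the truncated integration by parts vanish as `δ → 0`).

WHAT THIS IS NOT: not Euler, not Navier–Stokes; no statement about blow-up — calculus of the
Lemma 6/7 kernel of the 1-D periodic wall MODEL. `violates:` none — MODEL.
-/

noncomputable section

open Set Filter Real MeasureTheory intervalIntegral
open _root_.Topology

namespace Literature.Analysis.FluidPDE

namespace ChoiEtAl2017

/-! ### §1 Phases -/

/-- `μx ∈ (0, π/2)` for `x ∈ (0, ½L)`. [folklore] -/
private theorem phase_Ioo' {L x : ℝ} (hL : 0 < L) (hx : x ∈ Ioo 0 (L / 2)) :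
    π * x / L ∈ Ioo 0 (π / 2) := by
  constructor
  · exact div_pos (mul_pos Real.pi_pos hx.1) hL
  · rw [div_lt_iff₀ hL]
    nlinarith [hx.2, Real.pi_pos]

/-- `μx ∈ (0, π/2]` for `x ∈ (0, ½L]`. [folklore] -/
private theorem phase_Ioc' {L x : ℝ} (hL : 0 < L) (hx : x ∈ Ioc 0 (L / 2)) :
    π * x / L ∈ Ioc 0 (π / 2) := by
  constructor
  · exact div_pos (mul_pos Real.pi_pos hx.1) hL
  · rw [div_le_iff₀ hL]
    nlinarith [hx.2, Real.pi_pos]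

/-- `sin(μx) > 0` for `x ∈ (0, ½L]` (the phase `μx = πx/L` of the period-`L` model).
[cite: ChoiHouKiselevLuoSverakYao2017, §4 Lemma 6 (eqn_u_ker)] -/
theorem sin_phase_pos_of_mem_Ioc {L x : ℝ} (hL : 0 < L) (hx : x ∈ Ioc 0 (L / 2)) :
    0 < Real.sin (π * x / L) := by
  have h := phase_Ioc' hL hx
  exact Real.sin_pos_of_pos_of_lt_pi h.1 (by linarith [h.2, Real.pi_pos])

/-- `tan(μx) > 0` for `x ∈ (0, ½L)` (the phase `μx = πx/L` of the period-`L` model).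
[cite: ChoiHouKiselevLuoSverakYao2017, §4 Lemma 6 (eqn_u_ker)] -/
theorem tan_phase_pos_of_mem_Ioo {L x : ℝ} (hL : 0 < L) (hx : x ∈ Ioo 0 (L / 2)) :
    0 < Real.tan (π * x / L) := by
  have h := phase_Ioo' hL hx
  exact Real.tan_pos_of_pos_of_lt_pi_div_two h.1 h.2

/-! ### §2 The cos/sin form of `s` and continuity of `K`, `G` in `x` off the diagonal -/

/-- **`s(x,y) = tan(μy)·cos(μx)/sin(μx)`** (an unconditional identity; it exhibits `x ↦ s(x,y)` as
continuous wherever `sin(μx) ≠ 0`, in particular at `x = ½L`, where Lean's `tan(π/2) = 0`).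
[cite: ChoiHouKiselevLuoSverakYao2017, §4 Lemma 6 (eqn_u_ker: s = tan(μy)/tan(μx))] -/
theorem hlRatio_eq_mul_cos_div_sin (L x y : ℝ) :
    hlRatio L x y = Real.tan (π * y / L) * Real.cos (π * x / L) / Real.sin (π * x / L) := by
  rw [hlRatio, Real.tan_eq_sin_div_cos (π * x / L), div_div_eq_mul_div]

/-- `x ↦ s(x,y)` is continuous on `(0, ½L]`. [cite: ChoiHouKiselevLuoSverakYao2017, §4 Lemma 6 (eqn_u_ker)] -/
theorem continuousOn_hlRatio_left {L : ℝ} (hL : 0 < L) (y : ℝ) :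
    ContinuousOn (fun x => hlRatio L x y) (Ioc 0 (L / 2)) := by
  have h : (fun x => hlRatio L x y) =
      fun x => Real.tan (π * y / L) * Real.cos (π * x / L) / Real.sin (π * x / L) :=
    funext fun x => hlRatio_eq_mul_cos_div_sin L x y
  rw [h]
  refine ContinuousOn.div (by fun_prop) (by fun_prop) fun x hx => ?_
  exact (sin_phase_pos_of_mem_Ioc hL hx).ne'

/-- `φ(s) = s log((s+1)/(s−1))` is continuous at every `s ≠ ±1`.
[cite: ChoiHouKiselevLuoSverakYao2017, §4 Lemma 6 (eqn_u_ker)] -/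
theorem continuousAt_hlKernelFn {s : ℝ} (h1 : s ≠ 1) (h2 : s ≠ -1) :
    ContinuousAt hlKernelFn s := by
  have hs1 : s - 1 ≠ 0 := sub_ne_zero.2 h1
  have hs2 : s + 1 ≠ 0 := fun h => h2 (by linarith)
  have hq : ContinuousAt (fun s : ℝ => (s + 1) / (s - 1)) s :=
    (continuousAt_id.add continuousAt_const).div (continuousAt_id.sub continuousAt_const) hs1
  have hlog : ContinuousAt (fun s : ℝ => Real.log ((s + 1) / (s - 1))) s :=
    hq.log (div_ne_zero hs2 hs1)
  unfold hlKernelFn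
  exact continuousAt_id.mul hlog

/-- `φ′(s) = log((s+1)/(s−1)) − 2s/(s²−1)` is continuous at every `s ≠ ±1`.
[cite: ChoiHouKiselevLuoSverakYao2017, §4 proof of Lemma 7, p. 12] -/
theorem continuousAt_hlKernelFnDeriv {s : ℝ} (h1 : s ≠ 1) (h2 : s ≠ -1) :
    ContinuousAt hlKernelFnDeriv s := by
  have hs1 : s - 1 ≠ 0 := sub_ne_zero.2 h1
  have hs2 : s + 1 ≠ 0 := fun h => h2 (by linarith)
  have hs3 : s ^ 2 - 1 ≠ 0 := by
    have : s ^ 2 - 1 = (s + 1) * (s - 1) := by ring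
    rw [this]; exact mul_ne_zero hs2 hs1
  have hq : ContinuousAt (fun s : ℝ => (s + 1) / (s - 1)) s :=
    (continuousAt_id.add continuousAt_const).div (continuousAt_id.sub continuousAt_const) hs1
  have hlog : ContinuousAt (fun s : ℝ => Real.log ((s + 1) / (s - 1))) s :=
    hq.log (div_ne_zero hs2 hs1)
  have hrat : ContinuousAt (fun s : ℝ => 2 * s / (s ^ 2 - 1)) s :=
    (continuousAt_const.mul continuousAt_id).div
      ((continuousAt_id.pow 2).sub continuousAt_const) hs3
  unfold hlKernelFnDeriv
  exact hlog.sub hrat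

/-- `s(x,y) ≥ 0` for `x ∈ (0, ½L]`, `y ∈ [0, ½L]` (the cos/sin form; at `x = ½L`, `s = 0`).
[cite: ChoiHouKiselevLuoSverakYao2017, §4 Lemma 6 (a)] -/
theorem hlRatio_nonneg' {L x y : ℝ} (hL : 0 < L) (hx : x ∈ Ioc 0 (L / 2))
    (hy : y ∈ Icc 0 (L / 2)) : 0 ≤ hlRatio L x y := by
  rw [hlRatio_eq_mul_cos_div_sin]
  have hpx := phase_Ioc' hL hx
  have hpy : π * y / L ∈ Icc 0 (π / 2) := by
    constructor
    · exact div_nonneg (mul_nonneg Real.pi_pos.le hy.1) hL.le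
    · rw [div_le_iff₀ hL]; nlinarith [hy.2, Real.pi_pos]
  have ht : 0 ≤ Real.tan (π * y / L) := Real.tan_nonneg_of_nonneg_of_le_pi_div_two hpy.1 hpy.2
  have hc : 0 ≤ Real.cos (π * x / L) :=
    Real.cos_nonneg_of_mem_Icc ⟨by linarith [hpx.1, Real.pi_pos], hpx.2⟩
  have hs : 0 < Real.sin (π * x / L) := sin_phase_pos_of_mem_Ioc hL hx
  positivity

/-- **`x ↦ K(x,y)` is continuous on `{x ∈ (0, ½L] : s(x,y) ≠ 1}`** (`y ∈ [0, ½L]`), i.e. off the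
diagonal — including the endpoint `x = ½L`. [cite: ChoiHouKiselevLuoSverakYao2017, §4 Lemma 6 (eqn_u_ker)] -/
theorem continuousOn_hlKernel_left {L y : ℝ} (hL : 0 < L) (hy : y ∈ Icc 0 (L / 2)) :
    ContinuousOn (fun x => hlKernel L x y) {x | x ∈ Ioc 0 (L / 2) ∧ hlRatio L x y ≠ 1} := by
  intro x hx
  have hs0 : 0 ≤ hlRatio L x y := hlRatio_nonneg' hL hx.1 hy
  have hK : ContinuousAt hlKernelFn (hlRatio L x y) :=
    continuousAt_hlKernelFn hx.2 (by linarith)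
  have hr : ContinuousWithinAt (fun x => hlRatio L x y) {x | x ∈ Ioc 0 (L / 2) ∧ hlRatio L x y ≠ 1} x :=
    ((continuousOn_hlRatio_left hL y) x hx.1).mono fun z hz => hz.1
  have h := ContinuousAt.comp_continuousWithinAt (f := fun x => hlRatio L x y) hK hr
  simpa only [Function.comp_def, hlKernel] using h

/-- **`x ↦ G(x,y)` is continuous on `{x ∈ (0, ½L] : s(x,y) ≠ 1}`** (`y ∈ [0, ½L]`).
[cite: ChoiHouKiselevLuoSverakYao2017, §4 proof of Lemma 7, p. 12 (G = K_x)] -/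
theorem continuousOn_hlKernelDx_left {L y : ℝ} (hL : 0 < L) (hy : y ∈ Icc 0 (L / 2)) :
    ContinuousOn (fun x => hlKernelDx L x y) {x | x ∈ Ioc 0 (L / 2) ∧ hlRatio L x y ≠ 1} := by
  intro x hx
  have hs0 : 0 ≤ hlRatio L x y := hlRatio_nonneg' hL hx.1 hy
  have hD : ContinuousAt hlKernelFnDeriv (hlRatio L x y) :=
    continuousAt_hlKernelFnDeriv hx.2 (by linarith)
  have hr : ContinuousWithinAt (fun x => hlRatio L x y) {x | x ∈ Ioc 0 (L / 2) ∧ hlRatio L x y ≠ 1} x :=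
    ((continuousOn_hlRatio_left hL y) x hx.1).mono fun z hz => hz.1
  have h1 : ContinuousWithinAt (fun x => hlKernelFnDeriv (hlRatio L x y))
      {x | x ∈ Ioc 0 (L / 2) ∧ hlRatio L x y ≠ 1} x :=
    ContinuousAt.comp_continuousWithinAt (f := fun x => hlRatio L x y) hD hr
  have hsin : Real.sin (π * x / L) ≠ 0 := (sin_phase_pos_of_mem_Ioc hL hx.1).ne'
  have h2 : ContinuousWithinAt (fun x => -(π / L) * Real.tan (π * y / L) / Real.sin (π * x / L) ^ 2)
      {x | x ∈ Ioc 0 (L / 2) ∧ hlRatio L x y ≠ 1} x := by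
    refine ContinuousAt.continuousWithinAt ?_
    exact continuousAt_const.div ((Real.continuous_sin.continuousAt.comp (by fun_prop)).pow 2)
      (pow_ne_zero 2 hsin)
  unfold hlKernelDx
  exact h2.mul h1

/-! ### §3 The levels of `s`: reflection `φ(1/s) = φ(s)/s²`, `K` at a point of prescribed `s` -/

/-- **`φ(1/s) = φ(s)/s²`** for `s ≠ 0` (the value of `K` at the mirror point: `s(y,x) = 1/s(x,y)`).
[cite: ChoiHouKiselevLuoSverakYao2017, §4 proof of Lemma 7, p. 12 (s(y,x) = 1/s(x,y) in T)] -/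
theorem hlKernelFn_inv {s : ℝ} (hs : s ≠ 0) : hlKernelFn (1 / s) = hlKernelFn s / s ^ 2 := by
  unfold hlKernelFn
  have h1 : (1 / s + 1) / (1 / s - 1) = -((s + 1) / (s - 1)) := by
    rcases eq_or_ne s 1 with h | h
    · subst h; norm_num
    · have hs1 : s - 1 ≠ 0 := sub_ne_zero.2 h
      field_simp
      ring
  rw [h1, Real.log_neg_eq_log]
  field_simp

/-- `s(c,y) = 1/λ` at a point `c` with `tan(μc) = λ tan(μy)` (`tan(μy) ≠ 0`, `λ ≠ 0`).
[cite: ChoiHouKiselevLuoSverakYao2017, §4 Lemma 6 (eqn_u_ker)] -/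
theorem hlRatio_of_tan_eq {L c y lam : ℝ} (hlam : lam ≠ 0) (hty : Real.tan (π * y / L) ≠ 0)
    (hc : Real.tan (π * c / L) = lam * Real.tan (π * y / L)) : hlRatio L c y = 1 / lam := by
  rw [hlRatio, hc]
  field_simp

/-- **`K` is constant on a level of `s`**: if `tan(μc) = λ·tan(μy)` then `K(c,y) = φ(1/λ)`.
[cite: ChoiHouKiselevLuoSverakYao2017, §4 Lemma 6 (K = φ(s), s = tan(μy)/tan(μx))] -/
theorem hlKernel_of_tan_eq {L c y lam : ℝ} (hlam : lam ≠ 0) (hty : Real.tan (π * y / L) ≠ 0)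
    (hc : Real.tan (π * c / L) = lam * Real.tan (π * y / L)) :
    hlKernel L c y = hlKernelFn (1 / lam) := by
  rw [hlKernel, hlRatio_of_tan_eq hlam hty hc]

/-- At the lower truncation point (`tan(μc₋) = tan(μy)/(1+δ)`): `K(c₋,y) = φ(1+δ)`.
[cite: ChoiHouKiselevLuoSverakYao2017, §4 proof of Lemma 7, p. 12 (K_x, symmetrisation)] -/
theorem hlKernel_lower_eq {L c y δ : ℝ} (hδ : 0 < δ) (hty : Real.tan (π * y / L) ≠ 0)
    (hc : Real.tan (π * c / L) = Real.tan (π * y / L) / (1 + δ)) :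
    hlKernel L c y = hlKernelFn (1 + δ) := by
  have h1 : (1 + δ) ≠ 0 := by linarith
  have hc' : Real.tan (π * c / L) = (1 / (1 + δ)) * Real.tan (π * y / L) := by rw [hc]; ring
  rw [hlKernel_of_tan_eq (one_div_ne_zero h1) hty hc', one_div_one_div]

/-- At the upper truncation point (`tan(μc₊) = (1+δ)tan(μy)`): `K(c₊,y) = φ(1+δ)/(1+δ)²`.
[cite: ChoiHouKiselevLuoSverakYao2017, §4 proof of Lemma 7, p. 12 (K_x, symmetrisation)] -/
theorem hlKernel_upper_eq {L c y δ : ℝ} (hδ : 0 < δ) (hty : Real.tan (π * y / L) ≠ 0)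
    (hc : Real.tan (π * c / L) = (1 + δ) * Real.tan (π * y / L)) :
    hlKernel L c y = hlKernelFn (1 + δ) / (1 + δ) ^ 2 := by
  have h1 : (1 + δ) ≠ 0 := by linarith
  rw [hlKernel_of_tan_eq h1 hty hc, hlKernelFn_inv h1]

/-! ### §4 `φ′ ≥ 0` below the diagonal, `G ≤ 0` for `y < x`; bounds on `φ′` off the band -/

/-- `φ′(s) ≥ 0` for `0 ≤ s < 1` (`log((1+s)/(1−s)) ≥ 0` and `2s/(1−s²) ≥ 0`). [cite: ChoiHouKiselevLuoSverakYao2017, §4 Lemma 6 (c) (K decreasing in x for y < x)] -/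
theorem hlKernelFnDeriv_nonneg_of_lt_one {s : ℝ} (hs0 : 0 ≤ s) (hs1 : s < 1) :
    0 ≤ hlKernelFnDeriv s := by
  unfold hlKernelFnDeriv
  have h1 : 0 < 1 - s := by linarith
  have hq : (s + 1) / (s - 1) = -((1 + s) / (1 - s)) := by
    have : s - 1 = -(1 - s) := by ring
    rw [this, div_neg]
    ring_nf
  have hlog : 0 ≤ Real.log ((s + 1) / (s - 1)) := by
    rw [hq, Real.log_neg_eq_log]
    apply Real.log_nonneg
    rw [le_div_iff₀ h1]
    linarith
  have hfrac : 2 * s / (s ^ 2 - 1) ≤ 0 := by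
    apply div_nonpos_of_nonneg_of_nonpos (by linarith)
    nlinarith
  linarith

/-- **`G(x,y) ≤ 0` for `y < x`** (`x ∈ (0, ½L]`, `y ∈ [0, ½L)`): "`K(x,y)` is decreasing in `x`
for `y < x`" (Lemma 6 (c)) in derivative form. [cite: ChoiHouKiselevLuoSverakYao2017, §4 Lemma 6 (c) and proof of Lemma 7 p. 12 (I₁ ≥ 0)] -/
theorem hlKernelDx_nonpos {L x y : ℝ} (hL : 0 < L) (hx : x ∈ Ioc 0 (L / 2)) (hy : y ∈ Ico 0 (L / 2))
    (hyx : y < x) : hlKernelDx L x y ≤ 0 := by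
  have hs0 : 0 ≤ hlRatio L x y := hlRatio_nonneg' hL hx ⟨hy.1, hy.2.le⟩
  have hs1 : hlRatio L x y < 1 := by
    rw [hlRatio_eq_mul_cos_div_sin]
    have hsx : 0 < Real.sin (π * x / L) := sin_phase_pos_of_mem_Ioc hL hx
    rw [div_lt_one hsx]
    -- `tan(μy) cos(μx) < sin(μx)`, i.e. `sin(μy)cos(μx) < sin(μx)cos(μy)` — `sin(μ(x−y)) > 0`
    have hpy : π * y / L ∈ Ico 0 (π / 2) := by
      constructor
      · exact div_nonneg (mul_nonneg Real.pi_pos.le hy.1) hL.le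
      · rw [div_lt_iff₀ hL]; nlinarith [hy.2, Real.pi_pos]
    have hpx := phase_Ioc' hL hx
    have hcy : 0 < Real.cos (π * y / L) :=
      Real.cos_pos_of_mem_Ioo ⟨by linarith [hpy.1, Real.pi_pos], hpy.2⟩
    have hd : 0 < Real.sin (π * x / L - π * y / L) := by
      apply Real.sin_pos_of_pos_of_lt_pi
      · rw [sub_pos, div_lt_div_iff_of_pos_right hL]
        exact mul_lt_mul_of_pos_left hyx Real.pi_pos
      · linarith [hpx.2, hpy.1, Real.pi_pos]
    rw [Real.sin_sub] at hd
    rw [Real.tan_eq_sin_div_cos, div_mul_eq_mul_div, div_lt_iff₀ hcy]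
    linarith
  have hφ := hlKernelFnDeriv_nonneg_of_lt_one hs0 hs1
  have hty : 0 ≤ Real.tan (π * y / L) := by
    apply Real.tan_nonneg_of_nonneg_of_le_pi_div_two
    · exact div_nonneg (mul_nonneg Real.pi_pos.le hy.1) hL.le
    · rw [div_le_iff₀ hL]; nlinarith [hy.2, Real.pi_pos]
  unfold hlKernelDx
  have h1 : -(π / L) * Real.tan (π * y / L) / Real.sin (π * x / L) ^ 2 ≤ 0 := by
    apply div_nonpos_of_nonpos_of_nonneg
    · have : 0 < π / L := div_pos Real.pi_pos hL
      nlinarith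
    · positivity
  exact mul_nonpos_of_nonpos_of_nonneg h1 hφ

/-- **`|φ′(s)| ≤ log((2+δ)/δ) + 2(1+δ)/(δ(2+δ))` above the band** (`s ≥ 1 + δ`, `δ > 0`):
both `log((s+1)/(s−1))` and `2s/(s²−1)` are nonnegative and decreasing there.
[cite: ChoiHouKiselevLuoSverakYao2017, §4 proof of Lemma 7, p. 12 (G = K_x)] -/
theorem abs_hlKernelFnDeriv_le_of_ge {δ s : ℝ} (hδ : 0 < δ) (hs : 1 + δ ≤ s) :
    |hlKernelFnDeriv s| ≤ Real.log ((2 + δ) / δ) + 2 * (1 + δ) / (δ * (2 + δ)) := by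
  unfold hlKernelFnDeriv
  have hs1 : 0 < s - 1 := by linarith
  have hq1 : 1 ≤ (s + 1) / (s - 1) := by rw [le_div_iff₀ hs1]; linarith
  have hlog0 : 0 ≤ Real.log ((s + 1) / (s - 1)) := Real.log_nonneg hq1
  have hlog1 : Real.log ((s + 1) / (s - 1)) ≤ Real.log ((2 + δ) / δ) := by
    apply Real.log_le_log (div_pos (by linarith) hs1)
    rw [div_le_div_iff₀ hs1 hδ]
    nlinarith
  have hsq : 0 < s ^ 2 - 1 := by nlinarith
  have hfrac0 : 0 ≤ 2 * s / (s ^ 2 - 1) := div_nonneg (by linarith) hsq.le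
  have hfrac1 : 2 * s / (s ^ 2 - 1) ≤ 2 * (1 + δ) / (δ * (2 + δ)) := by
    rw [div_le_div_iff₀ hsq (by positivity)]
    -- `2s·δ(2+δ) ≤ 2(1+δ)(s²−1)` for `s ≥ 1+δ`
    nlinarith [mul_nonneg hδ.le (by linarith : (0 : ℝ) ≤ s - (1 + δ)),
      mul_nonneg (by linarith : (0 : ℝ) ≤ s - (1 + δ)) (by linarith : (0 : ℝ) ≤ s)]
  rw [abs_le]
  constructor <;> linarith

/-- **`|φ′(s)| ≤ log((2+δ)/δ) + 2(1+δ)/(δ(2+δ))` below the band** (`0 ≤ s ≤ 1/(1+δ)`).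
[cite: ChoiHouKiselevLuoSverakYao2017, §4 proof of Lemma 7, p. 12 (G = K_x)] -/
theorem abs_hlKernelFnDeriv_le_of_le {δ s : ℝ} (hδ : 0 < δ) (hs0 : 0 ≤ s) (hs : s ≤ 1 / (1 + δ)) :
    |hlKernelFnDeriv s| ≤ Real.log ((2 + δ) / δ) + 2 * (1 + δ) / (δ * (2 + δ)) := by
  unfold hlKernelFnDeriv
  have h1δ : 0 < 1 + δ := by linarith
  have hs1 : s < 1 := lt_of_le_of_lt hs (by rw [div_lt_one h1δ]; linarith)
  have h1s : 0 < 1 - s := by linarith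
  have hq : (s + 1) / (s - 1) = -((1 + s) / (1 - s)) := by
    have : s - 1 = -(1 - s) := by ring
    rw [this, div_neg]
    ring_nf
  have hlog0 : 0 ≤ Real.log ((s + 1) / (s - 1)) := by
    rw [hq, Real.log_neg_eq_log]
    apply Real.log_nonneg
    rw [le_div_iff₀ h1s]; linarith
  -- `s(1+δ) ≤ 1`
  have hsd : s * (1 + δ) ≤ 1 := by rwa [le_div_iff₀ h1δ] at hs
  have hlog1 : Real.log ((s + 1) / (s - 1)) ≤ Real.log ((2 + δ) / δ) := by
    rw [hq, Real.log_neg_eq_log]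
    apply Real.log_le_log (by positivity)
    rw [div_le_div_iff₀ h1s hδ]
    nlinarith
  have hsq : s ^ 2 - 1 < 0 := by nlinarith
  have hfrac0 : 2 * s / (s ^ 2 - 1) ≤ 0 := div_nonpos_of_nonneg_of_nonpos (by linarith) hsq.le
  have h1s2 : 0 < 1 - s ^ 2 := by nlinarith
  have hfrac1' : 2 * s / (1 - s ^ 2) ≤ 2 * (1 + δ) / (δ * (2 + δ)) := by
    rw [div_le_div_iff₀ h1s2 (by positivity)]
    -- `2sδ(2+δ) ≤ 2(1+δ)(1−s²)`: from `s(1+δ) ≤ 1`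
    nlinarith [mul_nonneg hs0 (by linarith : (0 : ℝ) ≤ 1 - s * (1 + δ)),
      mul_nonneg hδ.le (by linarith : (0 : ℝ) ≤ 1 - s * (1 + δ)), hs0, hδ.le]
  have hfrac1 : -(2 * (1 + δ) / (δ * (2 + δ))) ≤ 2 * s / (s ^ 2 - 1) := by
    have e : 2 * s / (s ^ 2 - 1) = -(2 * s / (1 - s ^ 2)) := by
      rw [← div_neg, neg_sub]
    rw [e]
    linarith
  rw [abs_le]
  constructor <;> linarith

/-- **`|φ′(s)| ≤ C(δ)` off the band** `((1+δ)⁻¹, 1+δ)` for `s ≥ 0`, `C(δ) = log((2+δ)/δ) +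
2(1+δ)/(δ(2+δ))`. [cite: ChoiHouKiselevLuoSverakYao2017, §4 proof of Lemma 7, p. 12 (G = K_x)] -/
theorem abs_hlKernelFnDeriv_le {δ s : ℝ} (hδ : 0 < δ) (hs0 : 0 ≤ s)
    (hs : s ≤ 1 / (1 + δ) ∨ 1 + δ ≤ s) :
    |hlKernelFnDeriv s| ≤ Real.log ((2 + δ) / δ) + 2 * (1 + δ) / (δ * (2 + δ)) := by
  rcases hs with h | h
  · exact abs_hlKernelFnDeriv_le_of_le hδ hs0 h
  · exact abs_hlKernelFnDeriv_le_of_ge hδ h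

/-- **`ω(y)cot(μy)·G(x,y) = −μ·ω(y)·φ′(s(x,y))/sin²(μx)`** for `y ∈ (0, ½L)` (`cot·tan = 1`): the
integrand of `I₂` has no `tan(μy)` blow-up at `y → ½L`. [cite: ChoiHouKiselevLuoSverakYao2017, §4 proof of Lemma 7, p. 12 (I₂ = −(1/π)∫∫ ω_r(x)ω_r(y)cot(y)G(x,y))] -/
theorem mul_cot_mul_hlKernelDx {L : ℝ} (hL : 0 < L) (ω : ℝ → ℝ) {y : ℝ} (hy : y ∈ Ioo 0 (L / 2))
    (x : ℝ) :
    ω y * Real.cot (π * y / L) * hlKernelDx L x y =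
      -(π / L) * ω y * hlKernelFnDeriv (hlRatio L x y) / Real.sin (π * x / L) ^ 2 := by
  have hpy := phase_Ioo' hL hy
  have hsy : Real.sin (π * y / L) ≠ 0 :=
    (Real.sin_pos_of_pos_of_lt_pi hpy.1 (by linarith [hpy.2, Real.pi_pos])).ne'
  have hcy : Real.cos (π * y / L) ≠ 0 :=
    (Real.cos_pos_of_mem_Ioo ⟨by linarith [hpy.1, Real.pi_pos], hpy.2⟩).ne'
  unfold hlKernelDx
  rw [Real.cot_eq_cos_div_sin, Real.tan_eq_sin_div_cos]
  field_simp

/-! ### §5 The distance between the two truncation points; `δ·φ(1+δ) → 0` -/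

/-- The auxiliary function `λ ↦ arctan(λτ)` has derivative `τ/(1+(λτ)²) ≤ 1` for `λ ≥ ½`, `τ ≥ 0`.
[folklore] -/
private theorem hasDerivAt_arctan_mul (τ lam : ℝ) :
    HasDerivAt (fun l : ℝ => Real.arctan (l * τ)) (1 / (1 + (lam * τ) ^ 2) * τ) lam := by
  have h := ((hasDerivAt_id lam).mul_const τ).arctan
  simpa using h

/-- `τ/(1+(λτ)²) ≤ 1` for `λ ≥ ½`, `τ ≥ 0`. [folklore] -/
private theorem deriv_arctan_mul_le {τ lam : ℝ} (hτ : 0 ≤ τ) (hlam : 1 / 2 ≤ lam) :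
    1 / (1 + (lam * τ) ^ 2) * τ ≤ 1 := by
  rw [div_mul_eq_mul_div, one_mul, div_le_one (by positivity)]
  nlinarith [sq_nonneg (lam * τ - 1), mul_nonneg (by linarith : (0 : ℝ) ≤ lam - 1 / 2) hτ]

/-- **The two truncation points are `O(δ)` apart**: if `0 < c₋, c₊ < ½L`,
`tan(μc₋) = tan(μy)/(1+δ)`, `tan(μc₊) = (1+δ)tan(μy)` with `tan(μy) ≥ 0` and `0 < δ ≤ 1`, then
`c₊ − c₋ ≤ (2L/π)·δ` (uniformly in `y`) — the width of the excised band of the symmetrised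
principal value. [cite: ChoiHouKiselevLuoSverakYao2017, §4 proof of Lemma 7, p. 12] -/
theorem sub_le_of_tan_eq {L y δ cm cp : ℝ} (hL : 0 < L) (hδ : 0 < δ) (hδ1 : δ ≤ 1)
    (hty : 0 ≤ Real.tan (π * y / L)) (hcm : cm ∈ Ioo 0 (L / 2)) (hcp : cp ∈ Ioo 0 (L / 2))
    (hm : Real.tan (π * cm / L) = Real.tan (π * y / L) / (1 + δ))
    (hp : Real.tan (π * cp / L) = (1 + δ) * Real.tan (π * y / L)) :
    cp - cm ≤ 2 * L / π * δ := by
  set τ := Real.tan (π * y / L) with hτ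
  have hpm := phase_Ioo' hL hcm
  have hpp := phase_Ioo' hL hcp
  -- the phases are `arctan((1+δ)^{∓1} τ)`
  have e1 : π * cm / L = Real.arctan (1 / (1 + δ) * τ) := by
    rw [← Real.arctan_tan (x := π * cm / L) (by linarith [hpm.1, Real.pi_pos]) hpm.2, hm]
    congr 1; ring
  have e2 : π * cp / L = Real.arctan ((1 + δ) * τ) := by
    rw [← Real.arctan_tan (x := π * cp / L) (by linarith [hpp.1, Real.pi_pos]) hpp.2, hp]
  -- mean value inequality for `g(λ) = arctan(λτ)` on `[1/(1+δ), 1+δ]`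
  set g : ℝ → ℝ := fun l => Real.arctan (l * τ) with hg
  have h1δ : 0 < 1 + δ := by linarith
  have hlo : 1 / 2 ≤ 1 / (1 + δ) := by
    rw [div_le_div_iff₀ (by norm_num) h1δ]; linarith
  have hab : 1 / (1 + δ) ≤ 1 + δ := by
    rw [div_le_iff₀ h1δ]; nlinarith
  have hgd : ∀ l, HasDerivAt g (1 / (1 + (l * τ) ^ 2) * τ) l := fun l => hasDerivAt_arctan_mul τ l
  have hmvt := (convex_Icc (1 / (1 + δ)) (1 + δ)).image_sub_le_mul_sub_of_deriv_le
    (f := g) (fun l _ => (hgd l).continuousAt.continuousWithinAt)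
    (fun l _ => (hgd l).differentiableAt.differentiableWithinAt)
    (C := 1) (fun l hl => by
      rw [interior_Icc] at hl
      rw [(hgd l).deriv]
      exact deriv_arctan_mul_le hty (hlo.trans hl.1.le))
    (1 / (1 + δ)) (left_mem_Icc.2 hab) (1 + δ) (right_mem_Icc.2 hab) hab
  -- `g(1+δ) − g(1/(1+δ)) ≤ (1+δ) − 1/(1+δ) ≤ 2δ`
  have hgap : (1 + δ) - 1 / (1 + δ) ≤ 2 * δ := by
    rw [sub_le_iff_le_add, ← sub_le_iff_le_add', le_div_iff₀ h1δ]
    nlinarith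
  have hdiff : π * cp / L - π * cm / L ≤ 2 * δ := by
    rw [e1, e2]
    have : g (1 + δ) - g (1 / (1 + δ)) ≤ 1 * ((1 + δ) - 1 / (1 + δ)) := hmvt
    simp only [hg] at this
    linarith
  have hπL : 0 < π / L := div_pos Real.pi_pos hL
  have : π / L * (cp - cm) ≤ 2 * δ := by
    have e : π / L * (cp - cm) = π * cp / L - π * cm / L := by ring
    rw [e]; exact hdiff
  calc cp - cm = (π / L * (cp - cm)) / (π / L) := by field_simp
    _ ≤ (2 * δ) / (π / L) := div_le_div_of_nonneg_right this hπL.le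
    _ = 2 * L / π * δ := by field_simp

/-- `log t ≤ 2√t` for `t > 0` (`log t = 2 log √t ≤ 2(√t − 1)`). [folklore] -/
private theorem log_le_two_mul_sqrt {t : ℝ} (ht : 0 < t) : Real.log t ≤ 2 * Real.sqrt t := by
  have hs : 0 < Real.sqrt t := Real.sqrt_pos.2 ht
  have h1 : Real.log t = 2 * Real.log (Real.sqrt t) := by
    rw [Real.log_sqrt ht.le]
    ring
  rw [h1]
  have := Real.log_le_sub_one_of_pos hs
  linarith

/-- **`δ·φ(1+δ) ≤ 2(1+δ)√(δ(2+δ))`** (`δ > 0`): the size `φ(1+δ) ∼ log(1/δ)` of `K` on the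
truncation levels times the `O(δ)` width — the boundary terms of the truncated integration by
parts vanish as `δ → 0`. [cite: ChoiHouKiselevLuoSverakYao2017, §4 proof of Lemma 7, p. 12 (the symmetrisation of I₂)] -/
theorem mul_hlKernelFn_one_add_le {δ : ℝ} (hδ : 0 < δ) :
    δ * hlKernelFn (1 + δ) ≤ 2 * (1 + δ) * Real.sqrt (δ * (2 + δ)) := by
  unfold hlKernelFn
  have hq : (1 + δ + 1) / (1 + δ - 1) = (2 + δ) / δ := by
    congr 1 <;> ring
  rw [hq]
  have hpos : 0 < (2 + δ) / δ := by positivity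
  have hlog := log_le_two_mul_sqrt hpos
  have hsq : δ * Real.sqrt ((2 + δ) / δ) = Real.sqrt (δ * (2 + δ)) := by
    have e : δ * (2 + δ) = δ ^ 2 * ((2 + δ) / δ) := by
      field_simp
    rw [e, Real.sqrt_mul (sq_nonneg δ), Real.sqrt_sq hδ.le]
  have h1 : 0 ≤ 1 + δ := by linarith
  calc δ * ((1 + δ) * Real.log ((2 + δ) / δ))
      = (1 + δ) * (δ * Real.log ((2 + δ) / δ)) := by ring
    _ ≤ (1 + δ) * (δ * (2 * Real.sqrt ((2 + δ) / δ))) := by gcongr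
    _ = 2 * (1 + δ) * (δ * Real.sqrt ((2 + δ) / δ)) := by ring
    _ = 2 * (1 + δ) * Real.sqrt (δ * (2 + δ)) := by rw [hsq]

/-- `φ(1+δ) ≥ 0`. [cite: ChoiHouKiselevLuoSverakYao2017, §4 Lemma 6 (a)] -/
theorem hlKernelFn_one_add_nonneg {δ : ℝ} (hδ : 0 < δ) : 0 ≤ hlKernelFn (1 + δ) :=
  hlKernelFn_nonneg (by linarith)

end ChoiEtAl2017

end Literature.Analysis.FluidPDE
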